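import Summits.BirchSwinnertonDyer.BirchSwinnertonDyer.Theorems.SignedLowerHalvesSmallImageLowerHalfBothSignsRttJunctionShaPairing
import Summits.BirchSwinnertonDyer.BirchSwinnertonDyer.Theorems.SignedLowerHalvesSmallImageLowerHalfBothSignsRttD2SeqSemilocPairLawsRed
import Literature.NumberTheory.ComplexMultiplication.EllipticUnits.ImaginaryQuadraticMainConjectureCarriersOCoresTransitive
import Literature.NumberTheory.GaloisCohomology.ShaRestrictedLayerFunctoriality
import Literature.NumberTheory.GaloisCohomology.ShaRestrictedShapiroLayerChange
import Literature.NumberTheory.GaloisCohomology.ShaRestrictedShapiroLayerConj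
import HarnessLib

/-!
# Route `SignedLowerHalves`, crux L `SmallImageLowerHalfBothSigns` (stmt-BirchSwinnertonDyer-23599), line `rtt_w3` v33 — stub S3α″ (`stub_junctionShaPi_ns`),
# brick α5′-2a: THE LAYER MAPS of the Poitou–Tate socket in honda's currency — `Ш²_P(K_n, X_k)` is stable under cores / red / conj inside honda's layer groups,
# and the `Ш¹`-side `Y n k = Ш¹_P(K_n, A[p^k])` with its restriction / inclusion / conjugation maps

INPUTS hand `bsd-inputs-honda-p1` g29 under LEAD `cruxlead-stmt-BirchSwinnertonDyer-23599` (cell `bsd-ssimc`); helper `--supports stmt-BirchSwinnertonDyer-23599`.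
DEFINITIONS WITH BODIES (`muTwistORedHom`, `resYO`, `inclYO`, `conjYO`) + THEOREMS; no named fact, no instance, no `sorry`. The one-variable `𝒪`-coefficient twin of
§1–§3 of the tree's IMC template `Literature/…/EllipticUnits/ImaginaryQuadraticMainConjectureLayerDualityMaps.lean`, for an ABSTRACT discrete module `A` (torsion levels
`torsRep A hstab p k`, -w3's currency) on the `Ш¹`-side and honda's `X_k = 𝒪 ⊗ μ_{p^k} ⊗ θ′` (`muTwistO`, layer groups `cycLayerCohO S κ θ′ P n k 2`) on the `Ш²`-side.

* §1 `muTwistORedHom` — the reduction `X_{k+1} → X_k` (`oMuRed`) as a morphism of discrete `Γ_K`-modules.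
* §2 the `Ш²`-side: `cycLayerCoresO_mem_layerShaRestricted` (cores = `relCor`, `relCoresO_eq_relCor` + `ShaLayer.relCor_mem_layerShaRestricted_two`),
  `cycLayerRedO_mem_layerShaRestricted` (`levelRedO` = `H²` of `muTwistORedHom`, `cohomologyMap_mem_layerShaRestricted_two`), `cycLayerConjO_mem_layerShaRestricted`
  (`layerConj_toUnramifiedQuot`, g28), `cohomologyMap_muTwistORedHom_eq_cycLayerRedO`.
* §3 the `Ш¹`-side `Y n k = ShaLayer.layerShaRestricted P (torsRep A hstab p k) (U_n) 1`: `shaOneO_torsion` (`p^k`-torsion), the maps `resYO` (restriction `K_n → K_{n+1}`), `inclYO`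
  (`A[p^k] ⊆ A[p^{k+1}]`, -w3's `torsInclHom`), `conjYO` (conjugation), with their `coe_` lemmas.
The comparison maps `ι_{n,k} : Y n k → Sel_str(K_∞, A)` and the naturality of the pairing are the sequel bricks.
HONEST FRAMING: bookkeeping; α5′, S3α″, crux L and BSD are NOT proved here and remain OPEN; BSD is proved for NO curve.
References: [MilneADT2006] I §4 (p. 56), p. 65; [NeukirchSchmidtWingberg2008] I §5 (1.5.3), I §6 (1.6.4)–(1.6.5); [SerreGaloisCohomology1997] I §2.5; [SerreLocalFields1979] VII §5;
[Kato2004Asterisque] §8.2 (p. 180); [JohnsonLeungKings2011] §5.4 Lemma 5.8.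
-/

set_option autoImplicit false
set_option linter.dupNamespace false -- D-0017: single-problem summit, the namespace repeats the problem name by design
noncomputable section

open scoped Classical
open NumberField IsDedekindDomain Field Function CategoryTheory

namespace Summit.BirchSwinnertonDyer.BirchSwinnertonDyer.Theorems.SmallImageRttJunctionSha

open Literature.NumberTheory.EllipticCurves Literature.NumberTheory.GaloisRepresentations
  Literature.NumberTheory.GaloisRepresentations.DiscreteGaloisModule Literature.NumberTheory.GaloisCohomology Literature.NumberTheory.GaloisCohomology.ShaLayer
  Literature.NumberTheory.ComplexMultiplication.EllipticUnits Literature.NumberTheory.ComplexMultiplication.EllipticUnits.JohnsonLeungKings2011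
  Summit.BirchSwinnertonDyer.BirchSwinnertonDyer.Theorems.SmallImageRttD2J1 Summit.BirchSwinnertonDyer.BirchSwinnertonDyer.Theorems.SmallImageRttD2Seq

/-! ## §1 The reduction `X_{k+1} → X_k` as a morphism; finite index of the layers -/

section Red

variable {K : Type} [Field K] [NumberField K] {p : ℕ} [Fact p.Prime] (S : Set (PadicAlgCl p)) (θ' : absoluteGaloisGroup K →ₜ* (padicCoeffIntegers S)ˣ)

/-- **The reduction `𝒪 ⊗ μ_{p^{k+1}} ⊗ θ′ → 𝒪 ⊗ μ_{p^k} ⊗ θ′`** (`id ⊗ (ζ ↦ ζ^p)`, honda's `oMuRed`) as a morphism of discrete `Γ_K`-modules (equivariance `oMuRed_muTwistO`).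
[cite: Kato2004Asterisque, §8.2 (p. 180)] -/
def muTwistORedHom (k : ℕ) : (muTwistO S θ' (k + 1)).toTopRep ⟶ (muTwistO S θ' k).toTopRep :=
  TopRep.ofHom ⟨⟨(oMuRed S k).toIntLinearMap, continuous_of_discreteTopology⟩, fun σ ↦ by
    ext v
    exact oMuRed_muTwistO S θ' k σ v⟩

omit [NumberField K] in
/-- Unfolding `muTwistORedHom`. [cite: Kato2004Asterisque, §8.2 (p. 180)] -/
@[simp] theorem muTwistORedHom_apply (k : ℕ) (v : OMuCarrier K S (p ^ (k + 1))) : (muTwistORedHom S θ' k).hom v = oMuRed S k v := rfl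

end Red

/-! ## §2 The `Ш²`-side: `Ш²_P(K_n, X_k)` is stable under cores / red / conj -/

section ShaTwo

variable {K : Type} [Field K] [NumberField K] {p : ℕ} [Fact p.Prime] (S : Set (PadicAlgCl p)) (κ : ZpExtension K p)
  (θ' : absoluteGaloisGroup K →ₜ* (padicCoeffIntegers S)ˣ) (P : Set (HeightOneSpectrum (𝓞 K)))
  (hNP : ∀ n : ℕ, ramificationSubgroup K P ≤ κ.layerSubgroup n)
  (hμ : ∀ k : ℕ, ramificationSubgroup K P ≤ ContinuousRep.ker (muTwistO S θ' k))

include hNP hμ in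
/-- **`cor_{K_{n+1}/K_n}` preserves `Ш²_P`** (`cycLayerCoresO = relCoresO` IS the tree's relative corestriction `relCor` (`relCoresO_eq_relCor`); then
`ShaLayer.relCor_mem_layerShaRestricted_two`). [cite: MilneADT2006, I §4 (p. 65)] [cite: NeukirchSchmidtWingberg2008, I §5 Prop. (1.5.3)] -/
theorem cycLayerCoresO_mem_layerShaRestricted (n k : ℕ) {y : cycLayerCohO S κ θ' P (n + 1) k 2}
    (hy : y ∈ layerShaRestricted P (muTwistO S θ' k) (κ.layerSubgroup (n + 1)) 2) :
    cycLayerCoresO S κ θ' P n k 2 y ∈ layerShaRestricted P (muTwistO S θ' k) (κ.layerSubgroup n) 2 := by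
  letI : Fintype (absoluteGaloisGroup K ⧸ κ.layerSubgroup (n + 1)) := Fintype.ofFinite _
  haveI : ((κ.layerSubgroup (n + 1)).map (toUnramifiedQuot K P)).FiniteIndex := finiteIndex_imGS' P (κ.isOpen_layerSubgroup (n + 1))
  letI : Fintype (GaloisGroupUnramifiedOutside K P ⧸ (κ.layerSubgroup (n + 1)).map (toUnramifiedQuot K P)) := Fintype.ofFinite _
  haveI : (((κ.layerSubgroup (n + 1)).map (toUnramifiedQuot K P)).subgroupOf ((κ.layerSubgroup n).map (toUnramifiedQuot K P))).FiniteIndex := by infer_instance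
  letI : Fintype (↥((κ.layerSubgroup n).map (toUnramifiedQuot K P)) ⧸
      ((κ.layerSubgroup (n + 1)).map (toUnramifiedQuot K P)).subgroupOf ((κ.layerSubgroup n).map (toUnramifiedQuot K P))) := Fintype.ofFinite _
  have h := relCor_mem_layerShaRestricted_two P (muTwistO S θ' k) (κ.layerSubgroup n) (κ.layerSubgroup (n + 1)) (κ.isOpen_layerSubgroup n)
    (κ.isOpen_layerSubgroup (n + 1)) (κ.layerSubgroup_antitone (Nat.le_succ n)) (hNP n) (hNP (n + 1)) (hμ k) hy
  rw [cycLayerCoresO, relCoresO_eq_relCor]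
  exact h

omit [NumberField K] in
/-- **`H²` of `muTwistORedHom` on the layer IS honda's `cycLayerRedO`** (both are Mathlib's functoriality of continuous cohomology in the coefficients along `oMuRed`).
[cite: Kato2004Asterisque, §8.2 (p. 180)] -/
theorem cohomologyMap_muTwistORedHom_eq_cycLayerRedO (n k i : ℕ) (y : cycLayerCohO S κ θ' P n (k + 1) i) :
    (cohomologyMap (subgroupRepMap (ContinuousRep.invariantsHom (N := ramificationSubgroup K P) (muTwistORedHom S θ' k)) ((κ.layerSubgroup n).map (toUnramifiedQuot K P))) i).hom y =
      cycLayerRedO S κ θ' P n k i y := by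
  rw [cycLayerRedO, levelRedO_apply]
  exact congrArg (fun T ↦ TopModuleCat.Hom.hom T y)
    (continuousCohomology_map_congr rfl
      (resIdHom (subgroupRepMap (ContinuousRep.invariantsHom (N := ramificationSubgroup K P) (muTwistORedHom S θ' k)) ((κ.layerSubgroup n).map (toUnramifiedQuot K P))))
      (levelMapHomO S P θ' (κ.layerSubgroup n) (oMuRed S k) (oMuRed_muTwistO S θ' k)) (fun w ↦ Subtype.ext rfl) i)

include hNP hμ in
/-- **The reduction `X_{k+1} → X_k` preserves `Ш²_P`** (`cohomologyMap_mem_layerShaRestricted_two` along `muTwistORedHom`). [cite: MilneADT2006, I §4 (p. 56)] [cite: Kato2004Asterisque, §8.2 (p. 180)] -/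
theorem cycLayerRedO_mem_layerShaRestricted (n k : ℕ) {y : cycLayerCohO S κ θ' P n (k + 1) 2}
    (hy : y ∈ layerShaRestricted P (muTwistO S θ' (k + 1)) (κ.layerSubgroup n) 2) :
    cycLayerRedO S κ θ' P n k 2 y ∈ layerShaRestricted P (muTwistO S θ' k) (κ.layerSubgroup n) 2 := by
  rw [← cohomologyMap_muTwistORedHom_eq_cycLayerRedO]
  exact cohomologyMap_mem_layerShaRestricted_two P (muTwistO S θ' (k + 1)) (muTwistO S θ' k) (κ.layerSubgroup n) (κ.isOpen_layerSubgroup n) (hNP n)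
    (hμ (k + 1)) (hμ k) (muTwistORedHom S θ' k) hy

/-- **Conjugation preserves `Ш²_P`** (`cycLayerConjO … δ = ShaLayer.layerConj … (π δ)`, g28; `conjMap_mem_layerShaRestricted`). [cite: MilneADT2006, I §4 (p. 56)] [cite: SerreLocalFields1979, VII §5] -/
theorem cycLayerConjO_mem_layerShaRestricted (n k : ℕ) (δ : absoluteGaloisGroup K) {y : cycLayerCohO S κ θ' P n k 2}
    (hy : y ∈ layerShaRestricted P (muTwistO S θ' k) (κ.layerSubgroup n) 2) :
    cycLayerConjO S κ θ' P n k 2 δ y ∈ layerShaRestricted P (muTwistO S θ' k) (κ.layerSubgroup n) 2 := by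
  rw [← layerConj_toUnramifiedQuot]
  exact conjMap_mem_layerShaRestricted P (muTwistO S θ' k) (κ.layerSubgroup n) (toUnramifiedQuot K P δ) 2 hy

end ShaTwo

/-! ## §3 The `Ш¹`-side `Y n k = Ш¹_P(K_n, A[p^k])` and its structure maps -/

section ShaOne

variable {K : Type} [Field K] [NumberField K] {p : ℕ} [Fact p.Prime] (κ : ZpExtension K p) (P : Set (HeightOneSpectrum (𝓞 K)))
  (M : Type) [AddCommGroup M] [DistribMulAction (absoluteGaloisGroup K) M] [TopologicalSpace M] [DiscreteTopology M]
  (hstab : ∀ m : M, IsOpen (MulAction.stabilizer (absoluteGaloisGroup K) m : Set (absoluteGaloisGroup K)))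

omit [NumberField K] [Fact p.Prime] in
/-- The coefficients `(A[p^k])^{N_P}` are killed by `p^k`. [folklore] -/
theorem torsRepCoeff_torsion (k : ℕ) (w : (DiscreteGaloisModule.quotientInvariants (torsRep M hstab p k) (ramificationSubgroup K P)).toTopRep) :
    ((p ^ k : ℕ) : ℤ) • w = 0 := by
  apply Subtype.ext
  rw [Submodule.coe_smul, Submodule.coe_zero, natCast_zsmul]
  exact torsionPow_nsmul_eq_zero M k _

/-- **`Y n k = Ш¹_P(K_n, A[p^k])` is `p^k`-torsion** (all of `H¹((U_n)_P, (A[p^k])^{N_P})` is: classes are represented on compact sets of cochains with `p^k`-torsion values,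
the tree's `continuousCohomology_exists_forall_smul_eq_zero`). [cite: MilneADT2006, I §4 (p. 56)] [cite: Kato2004Asterisque, §8.2 (p. 180)] -/
theorem shaOneO_torsion (n k : ℕ) (z : ↥(layerShaRestricted P (torsRep M hstab p k) (κ.layerSubgroup n) 1)) : p ^ k • z = 0 := by
  haveI : CompactSpace ((κ.layerSubgroup n).map (toUnramifiedQuot K P)) :=
    isCompact_iff_compactSpace.mp (isClosed_imGS' P (κ.isOpen_layerSubgroup n)).isCompact
  apply Subtype.ext
  rw [AddSubgroupClass.coe_nsmul, ZeroMemClass.coe_zero]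
  obtain ⟨m, hm⟩ := continuousCohomology_exists_forall_smul_eq_zero
    (subgroupRep ((DiscreteGaloisModule.quotientInvariants (torsRep M hstab p k) (ramificationSubgroup K P)).toTopRep) ((κ.layerSubgroup n).map (toUnramifiedQuot K P)))
    (fun _ ↦ Ideal.span {((p ^ k : ℕ) : ℤ)})
    (fun C _ ↦ ⟨0, fun r hr w _ ↦ by
      obtain ⟨c, rfl⟩ := Ideal.mem_span_singleton'.mp hr
      rw [mul_comm, mul_smul]
      exact torsRepCoeff_torsion P M hstab k (c • w)⟩) 1 (z : _)
  have h := hm ((p ^ k : ℕ) : ℤ) (Ideal.mem_span_singleton_self _)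
  rwa [Nat.cast_smul_eq_nsmul] at h

variable (hNP : ∀ n : ℕ, ramificationSubgroup K P ≤ κ.layerSubgroup n) (hA : ∀ k : ℕ, ramificationSubgroup K P ≤ ContinuousRep.ker (torsRep M hstab p k))

include hNP hA in
/-- **Restriction `Ш¹_P(K_n, A[p^k]) → Ш¹_P(K_{n+1}, A[p^k])`** (the tree's `resLe`, codomain-restricted by `resLe_mem_layerShaRestricted_one`).
[cite: MilneADT2006, I §4 (p. 56)] [cite: SerreGaloisCohomology1997, I §2.5] -/
def resYO (n k : ℕ) : ↥(layerShaRestricted P (torsRep M hstab p k) (κ.layerSubgroup n) 1) →+ ↥(layerShaRestricted P (torsRep M hstab p k) (κ.layerSubgroup (n + 1)) 1) :=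
  ((resLe ((DiscreteGaloisModule.quotientInvariants (torsRep M hstab p k) (ramificationSubgroup K P)).toTopRep)
      (Subgroup.map_mono (κ.layerSubgroup_antitone (Nat.le_succ n)) :
        (κ.layerSubgroup (n + 1)).map (toUnramifiedQuot K P) ≤ (κ.layerSubgroup n).map (toUnramifiedQuot K P)) 1).hom.toLinearMap.toAddMonoidHom.comp
    (layerShaRestricted P (torsRep M hstab p k) (κ.layerSubgroup n) 1).subtype).codRestrict _ fun z ↦
      resLe_mem_layerShaRestricted_one P (torsRep M hstab p k) (κ.layerSubgroup n) (κ.layerSubgroup (n + 1)) (κ.isOpen_layerSubgroup n)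
        (κ.isOpen_layerSubgroup (n + 1)) (κ.layerSubgroup_antitone (Nat.le_succ n)) (hNP n) (hNP (n + 1)) (hA k) z.2

/-- Values of `resYO`. [cite: SerreGaloisCohomology1997, I §2.5] -/
theorem coe_resYO (n k : ℕ) (z : layerShaRestricted P (torsRep M hstab p k) (κ.layerSubgroup n) 1) :
    (resYO κ P M hstab hNP hA n k z).1 =
      (resLe ((DiscreteGaloisModule.quotientInvariants (torsRep M hstab p k) (ramificationSubgroup K P)).toTopRep)
        (Subgroup.map_mono (κ.layerSubgroup_antitone (Nat.le_succ n)) :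
          (κ.layerSubgroup (n + 1)).map (toUnramifiedQuot K P) ≤ (κ.layerSubgroup n).map (toUnramifiedQuot K P)) 1).hom z.1 := rfl

include hNP hA in
/-- **Inclusion `Ш¹_P(K_n, A[p^k]) → Ш¹_P(K_n, A[p^{k+1}])`** (`H¹` of -w3's `torsInclHom`, codomain-restricted by `cohomologyMap_mem_layerShaRestricted_one`).
[cite: MilneADT2006, I §4 (p. 56)] [cite: Kato2004Asterisque, §8.2 (p. 180)] -/
def inclYO (n k : ℕ) : ↥(layerShaRestricted P (torsRep M hstab p k) (κ.layerSubgroup n) 1) →+ ↥(layerShaRestricted P (torsRep M hstab p (k + 1)) (κ.layerSubgroup n) 1) :=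
  ((cohomologyMap (subgroupRepMap (ContinuousRep.invariantsHom (N := ramificationSubgroup K P) (torsInclHom M hstab (p := p) (Nat.le_succ k)))
      ((κ.layerSubgroup n).map (toUnramifiedQuot K P))) 1).hom.toLinearMap.toAddMonoidHom.comp
    (layerShaRestricted P (torsRep M hstab p k) (κ.layerSubgroup n) 1).subtype).codRestrict _ fun z ↦
      cohomologyMap_mem_layerShaRestricted_one P (torsRep M hstab p k) (torsRep M hstab p (k + 1)) (κ.layerSubgroup n) (κ.isOpen_layerSubgroup n) (hNP n) (hA k)
        (hA (k + 1)) (torsInclHom M hstab (p := p) (Nat.le_succ k)) z.2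

/-- Values of `inclYO`. [cite: Kato2004Asterisque, §8.2 (p. 180)] -/
theorem coe_inclYO (n k : ℕ) (z : layerShaRestricted P (torsRep M hstab p k) (κ.layerSubgroup n) 1) :
    (inclYO κ P M hstab hNP hA n k z).1 =
      (cohomologyMap (subgroupRepMap (ContinuousRep.invariantsHom (N := ramificationSubgroup K P) (torsInclHom M hstab (p := p) (Nat.le_succ k)))
        ((κ.layerSubgroup n).map (toUnramifiedQuot K P))) 1).hom z.1 := rfl

/-- **Conjugation by `γ ∈ Γ_K` on `Ш¹_P(K_n, A[p^k])`** (`ShaLayer.layerConj (π γ)`, codomain-restricted by `conjMap_mem_layerShaRestricted`).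
[cite: SerreLocalFields1979, VII §5] [cite: MilneADT2006, I §4 (p. 56)] -/
def conjYO (n k : ℕ) (γ : absoluteGaloisGroup K) :
    ↥(layerShaRestricted P (torsRep M hstab p k) (κ.layerSubgroup n) 1) →+ ↥(layerShaRestricted P (torsRep M hstab p k) (κ.layerSubgroup n) 1) :=
  ((ShaLayer.layerConj P (torsRep M hstab p k) (κ.layerSubgroup n) (toUnramifiedQuot K P γ) 1).comp
    (layerShaRestricted P (torsRep M hstab p k) (κ.layerSubgroup n) 1).subtype).codRestrict _ fun z ↦
      conjMap_mem_layerShaRestricted P (torsRep M hstab p k) (κ.layerSubgroup n) (toUnramifiedQuot K P γ) 1 z.2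

/-- Values of `conjYO`. [cite: SerreLocalFields1979, VII §5] -/
theorem coe_conjYO (n k : ℕ) (γ : absoluteGaloisGroup K) (z : layerShaRestricted P (torsRep M hstab p k) (κ.layerSubgroup n) 1) :
    (conjYO κ P M hstab n k γ z).1 = ShaLayer.layerConj P (torsRep M hstab p k) (κ.layerSubgroup n) (toUnramifiedQuot K P γ) 1 z.1 := rfl

/-- `conjYO` is multiplicative in `γ` (`layerConj_mul`). [cite: SerreLocalFields1979, VII §5] -/
theorem conjYO_mul (n k : ℕ) (γ δ : absoluteGaloisGroup K) (z : layerShaRestricted P (torsRep M hstab p k) (κ.layerSubgroup n) 1) :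
    conjYO κ P M hstab n k (γ * δ) z = conjYO κ P M hstab n k γ (conjYO κ P M hstab n k δ z) := by
  apply Subtype.ext
  rw [coe_conjYO, coe_conjYO, coe_conjYO, map_mul]
  exact layerConj_mul P (torsRep M hstab p k) (toUnramifiedQuot K P γ) (toUnramifiedQuot K P δ) _

/-- `conjYO γ = id` for `γ ∈ U_n` (inner automorphisms act trivially; `layerConj_eq_self_of_mem`). [cite: SerreLocalFields1979, VII §5 Prop. 3] -/
theorem conjYO_eq_self_of_mem (n k : ℕ) {γ : absoluteGaloisGroup K} (hγ : γ ∈ κ.layerSubgroup n) (z : layerShaRestricted P (torsRep M hstab p k) (κ.layerSubgroup n) 1) :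
    conjYO κ P M hstab n k γ z = z := by
  apply Subtype.ext
  rw [coe_conjYO]
  exact layerConj_eq_self_of_mem P (torsRep M hstab p k) (Subgroup.mem_map_of_mem _ hγ) _

end ShaOne

end Summit.BirchSwinnertonDyer.BirchSwinnertonDyer.Theorems.SmallImageRttJunctionSha

end
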